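import Summits.NavierStokesRegularity.NavierStokesRegularity.Theorems.LerayQuarterDissipationFiniteDissipationLiouvilleVorticityAlignmentTools
import HarnessLib

/-!
# Crux `FiniteDissipationLiouville` (stmt-NavierStokesRegularity-22144): the VORTICITY-DIRECTION
# COHERENCE leaf — near a finite-dissipation Type-I singularity the vorticity direction never
# settles (the Giga–Miura continuous-alignment regime is excluded for the residue)

Theorems file of route `LerayQuarterDissipation` (lead prover ns-lqd-lead g8; `--supports` the
crux, line `birth`; portrait facts for the registered stub `stub_envelopeCriticalLiouville`).
Navier–Stokes regularity is NOT proved by anything here; no summit is.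

`𝒟_{C,K}`: Type-I ancient mild fields (KNSS gauge, `IsTypeIAncientMild C w`) with the law
`∫ ‖∇w(s)‖² ≤ K/√(−s)`; `ξ = ω/|ω|` is `vorticityDirection (curl (w t))`; the scale-invariant
vorticity size is `(−t)‖curl w(t,x)‖`.

* `false_of_alignedDirection_seq` — compactness core: no sequence of SINGULAR members of `𝒟_{C,K}`
  has, at `t = −1`, vorticity directions asymptotically aligned MODULO SIGN on growing balls above
  vanishing levels (the KNSS limit would have an aligned slice, which vanishes —
  `VorticityAlignment.slice_eq_zero_of_curl_parallel` — contradicting persistence of the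
  singularity);
* `directionCoherence_leaf` — **ONE-SLICE DIRECTION-COHERENCE LEAF** with a constant
  `δ = δ(C,K) > 0`: `δ`-coherence of `ξ` modulo sign on the `δ`-large-vorticity part of ONE
  parabolic ball `B(0, δ⁻¹√(−t))` at ONE instant forces boundedness at the apex;
* `directionOscillation_floor_of_singular` — contrapositive, **a portrait clause of the minimal
  counterexample: at EVERY instant a singular member carries two points of `B(0, δ⁻¹√(−t))` with
  scaled vorticity `> δ` whose directions are `δ`-apart modulo sign**;
* companion file `…VorticityAlignmentRegime`: the continuous-alignment hypothesis (D) of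
  Giga–Miura 2011, Thm 2.10 (sign-blind, any level, any modulus) FAILS for every singular member;
  periodic slices vanish; the crux restricted to direction-oscillating profiles.

HONEST FRAMING. `δ(C,K)` comes from compactness (no explicit value). The leaf removes no DSS
scenario by itself: a discretely self-similar profile with genuinely three-dimensional vorticity is
untouched. It is a kernel statement that any counterexample to the crux has, at all scales, a
vorticity direction field oscillating by a definite amount on its large-vorticity set — the
finite-dissipation Type-I analogue of the Constantin–Fefferman / Giga–Miura direction criteria,
proved here without the suitable-weak-solution apparatus (the dissipation law supplies `L⁶`
slices, which make the two-dimensional reduction of the aligned limit trivial).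

References: Giga–Miura 2011 (CMP 303 = HUPS #956), Thm 1.1 / Thm 2.10; Constantin–Fefferman 1993;
Koch–Nadirashvili–Seregin–Šverák 2009, §4; Tsai 1998, pp. 48–49.
-/

noncomputable section

-- the summit and its single sub-problem share the name (CONVENTIONS §1), as in every Theorems file
set_option linter.dupNamespace false

namespace Summit.NavierStokesRegularity.NavierStokesRegularity.Theorems.FiniteDissipationLiouville.VorticityAlignment

open MeasureTheory Set Filter Topology Metric Function
open Literature.Analysis Literature.Analysis.FluidPDE
open Summit.NavierStokesRegularity.NavierStokesRegularity.Theorems.FiniteDissipationLiouville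
open scoped ENNReal NNReal Laplacian RealInnerProductSpace
/-! ### The vorticity direction under rescaling and along limits -/

/-- **Vorticity direction of the parabolic rescaling**: `ξ[w_c(s)](x) = ξ[w(c²s)](cx)` for
`c > 0`. -/
theorem vorticityDirection_nsRescale {c : ℝ} (hc : 0 < c)
    (u : ℝ → EuclideanSpace ℝ (Fin 3) → EuclideanSpace ℝ (Fin 3)) (s : ℝ)
    (x : EuclideanSpace ℝ (Fin 3)) :
    vorticityDirection (curl (nsRescale c u s)) x =
      vorticityDirection (curl (u (c ^ 2 * s))) (c • x) := by
  rw [vorticityDirection_apply, vorticityDirection_apply, QuietVorticity.curl_nsRescale]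
  -- normalising a positive multiple of a vector gives the same unit vector
  -- (cf. `Theorems.inv_norm_smul_smul_of_pos`, ClockStretchingLaw line)
  have ha : 0 < c * c := mul_pos hc hc
  rw [norm_smul, Real.norm_of_nonneg ha.le, smul_smul, mul_inv, mul_comm (c * c)⁻¹, mul_assoc,
    inv_mul_cancel₀ ha.ne', mul_one]

/-- Normalisation is continuous away from zero: if `vⱼ → v ≠ 0` then `vⱼ/‖vⱼ‖ → v/‖v‖`. -/
theorem tendsto_unitDir {v : ℕ → EuclideanSpace ℝ (Fin 3)} {V : EuclideanSpace ℝ (Fin 3)}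
    (hv : Tendsto v atTop (𝓝 V)) (hV : V ≠ 0) :
    Tendsto (fun j => ‖v j‖⁻¹ • v j) atTop (𝓝 (‖V‖⁻¹ • V)) :=
  (hv.norm.inv₀ (norm_ne_zero_iff.2 hV)).smul hv

/-! ### The compactness core -/

/-- **No sequence of singular members of `𝒟_{C,K}` has asymptotically ALIGNED vorticity directions
(mod sign) on growing balls above vanishing levels at `t = −1`.** Along such a sequence the KNSS
limit `W` (compactness across members; law and singularity persist) has, at `t = −1`, a vorticity
everywhere parallel to one fixed vector (pointwise convergence of the gradients, continuity of the
normalisation away from zero); by `slice_eq_zero_of_curl_parallel` the slice vanishes — contradicting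
the singularity of `W` (forward uniqueness from the zero slice). [cite: KochNadirashviliSereginSverak2009, §4 (arXiv:0709.3599 p. 8)] [cite: Tsai1998, pp. 48–49] -/
theorem false_of_alignedDirection_seq {C K : ℝ}
    {w : ℕ → ℝ → EuclideanSpace ℝ (Fin 3) → EuclideanSpace ℝ (Fin 3)}
    (hwk : ∀ k, IsTypeIAncientMild C (w k))
    (hlaw : ∀ k, ∀ s : ℝ, s < 0 →
      ∫⁻ x, ‖fderiv ℝ (w k s) x‖ₑ ^ 2 ≤ ENNReal.ofReal (K / Real.sqrt (-s)))
    (hsing : ∀ k, ∀ ρ > 0, ∀ M : ℝ, ∃ t ∈ Ioo (-(ρ ^ 2)) (0 : ℝ),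
      ∃ x ∈ ball (0 : EuclideanSpace ℝ (Fin 3)) ρ, M < ‖w k t x‖)
    (halign : ∀ k : ℕ, ∀ x ∈ ball (0 : EuclideanSpace ℝ (Fin 3)) ((k : ℝ) + 1),
      ∀ y ∈ ball (0 : EuclideanSpace ℝ (Fin 3)) ((k : ℝ) + 1),
        1 / ((k : ℝ) + 1) < ‖curl (w k (-1)) x‖ → 1 / ((k : ℝ) + 1) < ‖curl (w k (-1)) y‖ →
        min ‖vorticityDirection (curl (w k (-1))) x - vorticityDirection (curl (w k (-1))) y‖
            ‖vorticityDirection (curl (w k (-1))) x + vorticityDirection (curl (w k (-1))) y‖ ≤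
          1 / ((k : ℝ) + 1)) :
    False := by
  obtain ⟨ψ, hψ, W, hW, hunif, -, hgrad⟩ := Compactness.seqLimit hwk
  have hψt : Tendsto ψ atTop atTop := hψ.tendsto_atTop
  have hWlaw : ∀ s : ℝ, s < 0 →
      ∫⁻ x, ‖fderiv ℝ (W s) x‖ₑ ^ 2 ≤ ENNReal.ofReal (K / Real.sqrt (-s)) :=
    Compactness.law_of_seqLimit (Kinf := K) (Kk := fun _ => K) hψt hlaw
      (fun ε hε => Eventually.of_forall fun _ => by linarith) hgrad
  have hWsing := Compactness.persistent_singularity_seq (w := fun j => w (ψ j))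
    (fun j => hwk (ψ j)) (fun j => hlaw (ψ j)) (fun j => hsing (ψ j)) hW hunif
  have h1 : (-1 : ℝ) < 0 := by norm_num
  -- pointwise convergence of the vorticities at `t = -1`
  have hcurl : ∀ z, Tendsto (fun j => curl (w (ψ j) (-1)) z) atTop (𝓝 (curl (W (-1)) z)) := by
    intro z
    simp only [curl_eq_curlCLM]
    exact ((curlCLM).continuous.tendsto _).comp (hgrad (-1) h1 z)
  -- the small parameter along the subsequence
  have hδ : Tendsto (fun j => 1 / ((ψ j : ℝ) + 1)) atTop (𝓝 0) :=
    (tendsto_one_div_add_atTop_nhds_zero_nat (𝕜 := ℝ)).comp hψt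
  have hR : Tendsto (fun j => (ψ j : ℝ) + 1) atTop atTop :=
    tendsto_atTop_add_const_right _ 1 (tendsto_natCast_atTop_atTop.comp hψt)
  -- eventually: a fixed point lies in the ball and a nonzero limit vorticity is above the level
  have hev_ball : ∀ z : EuclideanSpace ℝ (Fin 3), ∀ᶠ j in atTop,
      z ∈ ball (0 : EuclideanSpace ℝ (Fin 3)) ((ψ j : ℝ) + 1) := fun z => by
    filter_upwards [hR.eventually_gt_atTop ‖z‖] with j hj
    exact mem_ball_zero_iff.2 hj
  have hev_level : ∀ z : EuclideanSpace ℝ (Fin 3), curl (W (-1)) z ≠ 0 → ∀ᶠ j in atTop,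
      1 / ((ψ j : ℝ) + 1) < ‖curl (w (ψ j) (-1)) z‖ := by
    intro z hz
    have hpos : 0 < ‖curl (W (-1)) z‖ / 2 := by positivity
    have h2 : ∀ᶠ j in atTop, ‖curl (W (-1)) z‖ / 2 < ‖curl (w (ψ j) (-1)) z‖ := by
      have := (hcurl z).norm
      exact this.eventually (lt_mem_nhds (by linarith [norm_pos_iff.2 hz]))
    filter_upwards [h2, hδ.eventually (gt_mem_nhds hpos)] with j hj hj'
    exact hj'.trans hj
  -- Case A: the limit slice is irrotational ⇒ zero slice ⇒ regular
  by_cases hA : ∀ z, curl (W (-1)) z = 0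
  · exact CalmSlice.not_singular_of_zero_slice hW h1
      (QuietVorticity.slice_eq_zero_of_curl_eq_zero hW hWlaw h1 hA) hWsing
  -- Case B: a point with nonzero limit vorticity fixes the direction `e`
  push Not at hA
  obtain ⟨z₀, hz₀⟩ := hA
  set e : EuclideanSpace ℝ (Fin 3) := vorticityDirection (curl (W (-1))) z₀ with he_def
  have hpar : ∀ z, ∃ c : ℝ, curl (W (-1)) z = c • e := by
    intro z
    by_cases hz : curl (W (-1)) z = 0
    · exact ⟨0, by rw [hz, zero_smul]⟩
    -- directions along the subsequence
    have hξz : Tendsto (fun j => vorticityDirection (curl (w (ψ j) (-1))) z) atTop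
        (𝓝 (vorticityDirection (curl (W (-1))) z)) := by
      simp only [vorticityDirection_apply]
      exact tendsto_unitDir (hcurl z) hz
    have hξz₀ : Tendsto (fun j => vorticityDirection (curl (w (ψ j) (-1))) z₀) atTop (𝓝 e) := by
      rw [he_def]
      simp only [vorticityDirection_apply]
      exact tendsto_unitDir (hcurl z₀) hz₀
    have hmin : Tendsto (fun j =>
        min ‖vorticityDirection (curl (w (ψ j) (-1))) z - vorticityDirection (curl (w (ψ j) (-1))) z₀‖
          ‖vorticityDirection (curl (w (ψ j) (-1))) z + vorticityDirection (curl (w (ψ j) (-1))) z₀‖)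
        atTop (𝓝 (min ‖vorticityDirection (curl (W (-1))) z - e‖
          ‖vorticityDirection (curl (W (-1))) z + e‖)) :=
      ((hξz.sub hξz₀).norm).min ((hξz.add hξz₀).norm)
    have hle : ∀ᶠ j in atTop,
        min ‖vorticityDirection (curl (w (ψ j) (-1))) z - vorticityDirection (curl (w (ψ j) (-1))) z₀‖
          ‖vorticityDirection (curl (w (ψ j) (-1))) z + vorticityDirection (curl (w (ψ j) (-1))) z₀‖ ≤
          1 / ((ψ j : ℝ) + 1) := by
      filter_upwards [hev_ball z, hev_ball z₀, hev_level z hz, hev_level z₀ hz₀] with j hb hb₀ hl hl₀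
      exact halign (ψ j) z hb z₀ hb₀ hl hl₀
    have hmin0 : min ‖vorticityDirection (curl (W (-1))) z - e‖
        ‖vorticityDirection (curl (W (-1))) z + e‖ ≤ 0 := le_of_tendsto_of_tendsto hmin hδ hle
    have hωz : curl (W (-1)) z = ‖curl (W (-1)) z‖ • vorticityDirection (curl (W (-1))) z := by
      rw [vorticityDirection_apply, smul_smul, mul_inv_cancel₀ (norm_ne_zero_iff.2 hz), one_smul]
    rcases le_total ‖vorticityDirection (curl (W (-1))) z - e‖
        ‖vorticityDirection (curl (W (-1))) z + e‖ with hc | hc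
    · rw [min_eq_left hc] at hmin0
      have : vorticityDirection (curl (W (-1))) z = e :=
        sub_eq_zero.1 (norm_le_zero_iff.1 hmin0)
      refine ⟨‖curl (W (-1)) z‖, ?_⟩
      conv_lhs => rw [hωz, this]
    · rw [min_eq_right hc] at hmin0
      have : vorticityDirection (curl (W (-1))) z = -e :=
        eq_neg_of_add_eq_zero_left (norm_le_zero_iff.1 hmin0)
      refine ⟨-‖curl (W (-1)) z‖, ?_⟩
      conv_lhs => rw [hωz, this]
      rw [smul_neg, neg_smul]
  exact not_singular_of_curl_parallel_slice hW hWlaw h1 e hpar hWsing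

/-! ### The one-slice direction-coherence leaf and the direction-oscillation floor -/

/-- **ONE-SLICE DIRECTION-COHERENCE LEAF.** For all `C, K` there is `δ = δ(C,K) > 0` such that a
member of `𝒟_{C,K}` having ONE instant `t < 0` at which the vorticity direction `ξ = ω/|ω|` is
`δ`-COHERENT MODULO SIGN — `min(‖ξ(x) − ξ(y)‖, ‖ξ(x) + ξ(y)‖) ≤ δ` for all `x, y` in the parabolic
ball `B(0, δ⁻¹√(−t))` at which the scaled vorticity `(−t)‖ω(t,·)‖` exceeds `δ` — is bounded on some
backward cylinder at the origin (scale the instant to `−1`: `curl_nsRescale`,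
`vorticityDirection_nsRescale`; then `false_of_alignedDirection_seq`). A sign-blind one-slice form,
in the finite-dissipation Type-I class, of the Giga–Miura continuous-alignment criterion.
[cite: KochNadirashviliSereginSverak2009, §4 (arXiv:0709.3599 p. 8)] [cite: GigaMiura2011, Thm 2.10 (HUPS preprint #956 p. 10)] -/
theorem directionCoherence_leaf : ∀ (C K : ℝ), ∃ δ > 0,
    ∀ (w : ℝ → EuclideanSpace ℝ (Fin 3) → EuclideanSpace ℝ (Fin 3)),
      IsTypeIAncientMild C w →
      (∀ s : ℝ, s < 0 → ∫⁻ x, ‖fderiv ℝ (w s) x‖ₑ ^ 2 ≤ ENNReal.ofReal (K / Real.sqrt (-s))) →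
      (∃ t < 0, ∀ x ∈ ball (0 : EuclideanSpace ℝ (Fin 3)) (δ⁻¹ * Real.sqrt (-t)),
        ∀ y ∈ ball (0 : EuclideanSpace ℝ (Fin 3)) (δ⁻¹ * Real.sqrt (-t)),
          δ < (-t) * ‖curl (w t) x‖ → δ < (-t) * ‖curl (w t) y‖ →
          min ‖vorticityDirection (curl (w t)) x - vorticityDirection (curl (w t)) y‖
              ‖vorticityDirection (curl (w t)) x + vorticityDirection (curl (w t)) y‖ ≤ δ) →
      ¬ (∀ ρ > 0, ∀ M : ℝ, ∃ t ∈ Ioo (-(ρ ^ 2)) (0 : ℝ),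
        ∃ x ∈ ball (0 : EuclideanSpace ℝ (Fin 3)) ρ, M < ‖w t x‖) := by
  intro C K
  by_contra hcon
  push Not at hcon
  choose w' hw' hlaw' hq' hsing' using hcon
  choose t' ht' hq' using hq'
  have hpos : ∀ k : ℕ, (0 : ℝ) < 1 / ((k : ℝ) + 1) := fun k => by positivity
  set w : ℕ → ℝ → EuclideanSpace ℝ (Fin 3) → EuclideanSpace ℝ (Fin 3) :=
    fun k => w' _ (hpos k) with hw_def
  have hw : ∀ k, IsTypeIAncientMild C (w k) := fun k => hw' _ (hpos k)
  have hlaw := fun k => hlaw' _ (hpos k)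
  have hsing := fun k => hsing' _ (hpos k)
  set t : ℕ → ℝ := fun k => t' _ (hpos k) with ht_def
  have ht : ∀ k, t k < 0 := fun k => ht' _ (hpos k)
  have hq := fun k => hq' _ (hpos k)
  set c : ℕ → ℝ := fun k => Real.sqrt (-t k) with hc_def
  have hc : ∀ k, 0 < c k := fun k => Real.sqrt_pos.2 (neg_pos.2 (ht k))
  have hc2 : ∀ k, c k ^ 2 = -t k := fun k => Real.sq_sqrt (neg_nonneg.2 (ht k).le)
  set v : ℕ → ℝ → EuclideanSpace ℝ (Fin 3) → EuclideanSpace ℝ (Fin 3) :=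
    fun k => nsRescale (c k) (w k) with hv_def
  have hv : ∀ k, IsTypeIAncientMild C (v k) := fun k => isTypeIAncientMild_nsRescale (hw k) (hc k)
  have hvlaw : ∀ k, ∀ s : ℝ, s < 0 →
      ∫⁻ x, ‖fderiv ℝ (v k s) x‖ₑ ^ 2 ≤ ENNReal.ofReal (K / Real.sqrt (-s)) :=
    fun k => RecurrentReductionD.dissipationLaw_nsRescale (hlaw k) (hc k)
  have hvsing : ∀ k, ∀ ρ > 0, ∀ M : ℝ, ∃ t ∈ Ioo (-(ρ ^ 2)) (0 : ℝ),
      ∃ x ∈ ball (0 : EuclideanSpace ℝ (Fin 3)) ρ, M < ‖v k t x‖ :=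
    fun k => RecurrentReductionD.singularAtOrigin_nsRescale (hsing k) (hc k)
  -- transfer of the hypothesis to `t = -1`
  have e1 : ∀ k, c k ^ 2 * (-1 : ℝ) = t k := fun k => by rw [hc2]; ring
  have hball : ∀ k : ℕ, ∀ z ∈ ball (0 : EuclideanSpace ℝ (Fin 3)) ((k : ℝ) + 1),
      c k • z ∈ ball (0 : EuclideanSpace ℝ (Fin 3)) ((1 / ((k : ℝ) + 1))⁻¹ * Real.sqrt (-t k)) := by
    intro k z hz
    rw [mem_ball_zero_iff] at hz ⊢
    rw [norm_smul, Real.norm_of_nonneg (hc k).le, one_div, inv_inv, hc_def, mul_comm]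
    exact mul_lt_mul_of_pos_right hz (hc k)
  have hnorm : ∀ (k : ℕ) (z : EuclideanSpace ℝ (Fin 3)),
      ‖curl (v k (-1)) z‖ = (-t k) * ‖curl (w k (t k)) (c k • z)‖ := by
    intro k z
    rw [hv_def]
    dsimp only
    rw [QuietVorticity.curl_nsRescale, e1, norm_smul, Real.norm_of_nonneg (mul_self_nonneg _),
      ← sq, hc2]
  have hdir : ∀ (k : ℕ) (z : EuclideanSpace ℝ (Fin 3)), vorticityDirection (curl (v k (-1))) z =
      vorticityDirection (curl (w k (t k))) (c k • z) := by
    intro k z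
    rw [hv_def]
    dsimp only
    rw [vorticityDirection_nsRescale (hc k), e1]
  have halign : ∀ k : ℕ, ∀ x ∈ ball (0 : EuclideanSpace ℝ (Fin 3)) ((k : ℝ) + 1),
      ∀ y ∈ ball (0 : EuclideanSpace ℝ (Fin 3)) ((k : ℝ) + 1),
        1 / ((k : ℝ) + 1) < ‖curl (v k (-1)) x‖ → 1 / ((k : ℝ) + 1) < ‖curl (v k (-1)) y‖ →
        min ‖vorticityDirection (curl (v k (-1))) x - vorticityDirection (curl (v k (-1))) y‖
            ‖vorticityDirection (curl (v k (-1))) x + vorticityDirection (curl (v k (-1))) y‖ ≤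
          1 / ((k : ℝ) + 1) := by
    intro k x hx y hy hlx hly
    rw [hnorm] at hlx hly
    rw [hdir, hdir]
    exact hq k (c k • x) (hball k x hx) (c k • y) (hball k y hy) hlx hly
  exact false_of_alignedDirection_seq hv hvlaw hvsing halign

/-- **DIRECTION-OSCILLATION FLOOR OF A FINITE-DISSIPATION TYPE-I SINGULARITY** (portrait clause of
the registered stub `stub_envelopeCriticalLiouville`): for all `C, K` there is `δ = δ(C,K) > 0`
such that every SINGULAR member of `𝒟_{C,K}` has, at EVERY instant `t < 0`, two points of the
parabolic ball `B(0, δ⁻¹√(−t))` where the scaled vorticity exceeds `δ` and the vorticity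
directions differ by more than `δ` MODULO SIGN (`‖ξ(x) − ξ(y)‖ > δ` and `‖ξ(x) + ξ(y)‖ > δ`):
near a Type-I finite-dissipation singularity the vorticity direction never settles, at any scale.
[cite: GigaMiura2011, Thm 2.10 (HUPS preprint #956 p. 10)] [cite: KochNadirashviliSereginSverak2009, §4 (arXiv:0709.3599 p. 8)] -/
theorem directionOscillation_floor_of_singular : ∀ (C K : ℝ), ∃ δ > 0,
    ∀ (w : ℝ → EuclideanSpace ℝ (Fin 3) → EuclideanSpace ℝ (Fin 3)),
      IsTypeIAncientMild C w →
      (∀ s : ℝ, s < 0 → ∫⁻ x, ‖fderiv ℝ (w s) x‖ₑ ^ 2 ≤ ENNReal.ofReal (K / Real.sqrt (-s))) →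
      (∀ ρ > 0, ∀ M : ℝ, ∃ t ∈ Ioo (-(ρ ^ 2)) (0 : ℝ),
        ∃ x ∈ ball (0 : EuclideanSpace ℝ (Fin 3)) ρ, M < ‖w t x‖) →
      ∀ t < 0, ∃ x ∈ ball (0 : EuclideanSpace ℝ (Fin 3)) (δ⁻¹ * Real.sqrt (-t)),
        ∃ y ∈ ball (0 : EuclideanSpace ℝ (Fin 3)) (δ⁻¹ * Real.sqrt (-t)),
          δ < (-t) * ‖curl (w t) x‖ ∧ δ < (-t) * ‖curl (w t) y‖ ∧
          δ < ‖vorticityDirection (curl (w t)) x - vorticityDirection (curl (w t)) y‖ ∧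
          δ < ‖vorticityDirection (curl (w t)) x + vorticityDirection (curl (w t)) y‖ := by
  intro C K
  obtain ⟨δ, hδ, h⟩ := directionCoherence_leaf C K
  refine ⟨δ, hδ, fun w hw hlaw hsing t ht => ?_⟩
  by_contra hcon
  push Not at hcon
  refine h w hw hlaw ⟨t, ht, fun x hx y hy hlx hly => ?_⟩ hsing
  rcases le_or_gt ‖vorticityDirection (curl (w t)) x - vorticityDirection (curl (w t)) y‖ δ
    with h1 | h1
  · exact (min_le_left _ _).trans h1
  · exact (min_le_right _ _).trans (hcon x hx y hy hlx hly h1)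


end Summit.NavierStokesRegularity.NavierStokesRegularity.Theorems.FiniteDissipationLiouville.VorticityAlignment

end
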